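import Literature.Analysis.FluidPDE.HardSphereCollisionRecord

/-!
# The entropy clock `ClampedWindowDock` (stmt-AtomisticToContinuum-13735), V: the pathwise clamp remainder

Step (v) of the dock ("collisional term = clamped part + remainder: remainder pathwise
`≤ ‖∇λ_s‖_∞ ×` activity tail"), which is also the sentence "every dropped collision has a clamped partner, so
the pathwise remainder is `≤ ‖∇φ‖ ×` the activity tail" of the cruxes `EquilibriumClampedCollisionalWindowLD`
(stmt-13733) and `CollisionActivityTails` (stmt-13734). Pure combinatorics over the collision records of a curve
(`Literature.Analysis.FluidPDE.collisionSum`), for an arbitrary weight `ω : Fin N → [0, 1]` on the particles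
(the clamp `ω_i = 1{a_i ≤ V}` of the route) and an arbitrary per-record quantity `g` dominated by the impulse of
the first partner (`|g c| ≤ B ‖v_fst⁺ − v_fst⁻‖`; for the momentum transfer tested against `φ`,
`g c = (φ(x_fst) − φ(x_snd)) Δv_fst^k / 2` and `B = ‖∇φ‖_∞ ε / 2` at contact):

* `ofConfig_swap_postVel_fst`, `ofConfig_swap_preVel_fst` — the record of the swapped ordered pair `(j, i)` has
  as first-partner velocities the second-partner velocities of the record of `(i, j)` (regular geometry:
  `sepVec` odd at contact; the reflection law is even in the impact vector and swap-symmetric);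
* `norm_postVel_snd_sub_preVel_snd` — the two partners receive opposite impulses: `‖Δv_snd‖ = ‖Δv_fst‖`;
* `collisionSum_snd_eq_fst` — re-indexing an ordered-pair collision sum by the swap;
* `abs_collisionSum_unclamped_le` — **THE CLAMP REMAINDER BOUND**:
  `|Σ_c (1 − ω_{c.fst} ω_{c.snd}) g c| ≤ 2B Σ_i (1 − ω_i) A_i`, `A_i = Σ_{c : c.fst = i} ‖Δv_fst(c)‖` the
  (unnormalised) activity of particle `i` — with `ω_i = 1{a_i ≤ V}`, `a_i = (σ/τ) A_i`, `B = ‖∇φ‖_∞ ε_N/2` and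
  `w⁻¹ ε_N τ/σ = 1` this is `|w⁻¹(X − X_V)| ≤ ‖∇φ‖_∞ Σ_i a_i 1{a_i > V}`.

prover-pitem-stmt-AtomisticToContinuum-13735-0.
-/

noncomputable section

namespace Summit.AtomisticToContinuum.HydrodynamicLimit.Theorems.EntropyClockDock

open Set Finset
open Literature.Analysis.FluidPDE

variable {d : Type*} [Fintype d] {X : Type*} [TopologicalSpace X] {N : ℕ} {G : Geometry d X} {ε : ℝ}

/-! ### §1 Swapping the ordered pair of a record -/

omit [TopologicalSpace X] in
/-- The post-collisional velocity of the first partner of the swapped pair is that of the second partner.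
[folklore] -/
theorem ofConfig_swap_postVel_fst (z : Config N d X) (t : ℝ) (i j : Fin N) :
    (HardSphereCollisionRecord.ofConfig G ε z t j i).postVel.1 =
      (HardSphereCollisionRecord.ofConfig G ε z t i j).postVel.2 := rfl

/-- At contact in a regular geometry, the pre-collisional velocity of the first partner of the swapped pair
`(j, i)` is the pre-collisional velocity of the second partner of `(i, j)` (`sepVec` is odd at contact, the
reflection law is even in the impact direction and swap-symmetric). [folklore] -/
theorem ofConfig_swap_preVel_fst (hG : G.IsHardSphereRegular ε) {z : Config N d X} {i j : Fin N}
    (h : ‖G.sepVec (z i).1 (z j).1‖ ≤ ε) (t : ℝ) :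
    (HardSphereCollisionRecord.ofConfig G ε z t j i).preVel.1 =
      (HardSphereCollisionRecord.ofConfig G ε z t i j).preVel.2 := by
  simp only [HardSphereCollisionRecord.ofConfig_preVel]
  rw [hG.sepVec_comm _ _ h, reflectVel_neg]
  exact congrArg Prod.fst (reflectVel_swap (G.sepVec (z i).1 (z j).1) ((z i).2, (z j).2))

omit [TopologicalSpace X] in
/-- **Opposite impulses**: in every record computed from a configuration the second partner's velocity jump has
the norm of the first partner's (pair momentum conservation `v_i⁻ + v_j⁻ = v_i⁺ + v_j⁺`). [folklore] -/
theorem norm_postVel_snd_sub_preVel_snd (z : Config N d X) (t : ℝ) (i j : Fin N) :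
    ‖(HardSphereCollisionRecord.ofConfig G ε z t i j).postVel.2 -
        (HardSphereCollisionRecord.ofConfig G ε z t i j).preVel.2‖ =
      ‖(HardSphereCollisionRecord.ofConfig G ε z t i j).postVel.1 -
        (HardSphereCollisionRecord.ofConfig G ε z t i j).preVel.1‖ := by
  have h := HardSphereCollisionRecord.ofConfig_preVel_fst_add_snd G ε z t i j
  have e : (HardSphereCollisionRecord.ofConfig G ε z t i j).postVel.2 -
      (HardSphereCollisionRecord.ofConfig G ε z t i j).preVel.2 =
      -((HardSphereCollisionRecord.ofConfig G ε z t i j).postVel.1 -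
        (HardSphereCollisionRecord.ofConfig G ε z t i j).preVel.1) := by
    rw [neg_sub, sub_eq_iff_eq_add]
    have : (HardSphereCollisionRecord.ofConfig G ε z t i j).preVel.2 =
        (HardSphereCollisionRecord.ofConfig G ε z t i j).postVel.1 +
          (HardSphereCollisionRecord.ofConfig G ε z t i j).postVel.2 -
          (HardSphereCollisionRecord.ofConfig G ε z t i j).preVel.1 := by
      rw [← h]; abel
    rw [this]; abel
  rw [e, norm_neg]

/-! ### §2 Re-indexing a collision sum by the swap -/

/-- **Swap re-indexing.** For a curve in a regular geometry with finitely many collision times in `S`, summing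
`f (c.snd) · ‖Δv_fst(c)‖` over the ordered collision records equals summing `f (c.fst) · ‖Δv_fst(c)‖`: the swap is
a bijection of the ordered contact pairs at each collision time and exchanges the partners' (equal) impulses.
[folklore] -/
theorem collisionSum_snd_eq_fst (hG : G.IsHardSphereRegular ε) {γ : ℝ → Config N d X} {S : Set ℝ}
    (hfin : (collisionTimes G ε γ ∩ S).Finite) (f : Fin N → ℝ) :
    collisionSum G ε γ S (fun c => f c.snd * ‖c.postVel.1 - c.preVel.1‖) =
      collisionSum G ε γ S (fun c => f c.fst * ‖c.postVel.1 - c.preVel.1‖) := by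
  rw [collisionSum_eq_finset_sum hfin, collisionSum_eq_finset_sum hfin]
  refine Finset.sum_congr rfl fun t _ => ?_
  refine Finset.sum_equiv (Equiv.prodComm (Fin N) (Fin N)) (fun p => ?_) (fun p hp => ?_)
  · rw [Equiv.prodComm_apply, swap_mem_contactPairs_iff hG]
  · rw [Equiv.prodComm_apply, Prod.fst_swap, Prod.snd_swap]
    simp only [HardSphereCollisionRecord.ofConfig_snd, HardSphereCollisionRecord.ofConfig_fst]
    have hc := (mem_contactPairs.1 hp).2
    have hle : ‖G.sepVec (γ t p.1).1 (γ t p.2).1‖ ≤ ε := le_of_eq (mem_contactSet.1 hc).2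
    rw [ofConfig_swap_postVel_fst (γ t) t p.1 p.2, ofConfig_swap_preVel_fst hG hle,
      norm_postVel_snd_sub_preVel_snd]

/-! ### §3 The clamp remainder bound -/

omit [TopologicalSpace X] in
/-- Regrouping a first-partner-weighted impulse sum by particles: `Σ_c f(c.fst)‖Δv_fst(c)‖ = Σ_i f i · A_i` with
`A_i = Σ_{c : c.fst = i} ‖Δv_fst(c)‖` the unnormalised activity of `i`. [folklore] -/
theorem collisionSum_fst_mul_eq_sum {γ : ℝ → Config N d X} {S : Set ℝ}
    (hfin : (collisionTimes G ε γ ∩ S).Finite) (f : Fin N → ℝ) :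
    collisionSum G ε γ S (fun c => f c.fst * ‖c.postVel.1 - c.preVel.1‖) =
      ∑ i, f i * collisionSum G ε γ S (fun c => if c.fst = i then ‖c.postVel.1 - c.preVel.1‖ else 0) := by
  simp only [collisionSum_eq_finset_sum hfin, Finset.mul_sum]
  rw [Finset.sum_comm]
  refine Finset.sum_congr rfl fun t _ => ?_
  rw [Finset.sum_comm]
  refine Finset.sum_congr rfl fun p _ => ?_
  simp only [HardSphereCollisionRecord.ofConfig_fst, mul_ite, mul_zero]
  rw [Finset.sum_ite_eq Finset.univ p.1]
  simp

/-- **THE CLAMP REMAINDER BOUND (pathwise).** Let `γ` be a curve in a regular geometry with finitely many collision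
times in the window `S`, `ω : Fin N → [0,1]` a weight on the particles and `g` a real functional of collision
records with `|g c| ≤ B ‖Δv_fst(c)‖` on the records of `γ` in `S`. Then the part of `Σ_c g c` dropped by the
pair-symmetric clamp `ω_{c.fst} ω_{c.snd}` is controlled by the clamped-out activity:
`|Σ_c (1 − ω_{c.fst} ω_{c.snd}) g c| ≤ 2B Σ_i (1 − ω_i) A_i`, `A_i = Σ_{c : c.fst = i} ‖Δv_fst(c)‖`
(every dropped collision has a partner with `ω < 1`; `1 − ω_iω_j ≤ (1 − ω_i) + (1 − ω_j)`; the `ω_j`-half is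
re-indexed by the swap, `collisionSum_snd_eq_fst`). With `ω_i = 1{a_i ≤ V}`, `a_i = (σ/τ)A_i`,
`g = (φ(x_fst) − φ(x_snd))Δv_fst^k/2`, `B = ‖∇φ‖_∞ ε_N/2` and `w⁻¹ε_Nτ/σ = 1` this reads
`|w⁻¹(X − X_V)| ≤ ‖∇φ‖_∞ Σ_i a_i 1{a_i > V}`. [folklore] -/
theorem abs_collisionSum_unclamped_le (hG : G.IsHardSphereRegular ε) {γ : ℝ → Config N d X} {S : Set ℝ}
    (hfin : (collisionTimes G ε γ ∩ S).Finite) {ω : Fin N → ℝ} (hω0 : ∀ i, 0 ≤ ω i) (hω1 : ∀ i, ω i ≤ 1)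
    {g : HardSphereCollisionRecord d X N → ℝ} {B : ℝ}
    (hg : ∀ t ∈ collisionTimes G ε γ ∩ S, ∀ p ∈ contactPairs G ε (γ t),
      |g (HardSphereCollisionRecord.ofConfig G ε (γ t) t p.1 p.2)| ≤
        B * ‖(HardSphereCollisionRecord.ofConfig G ε (γ t) t p.1 p.2).postVel.1 -
          (HardSphereCollisionRecord.ofConfig G ε (γ t) t p.1 p.2).preVel.1‖) :
    |collisionSum G ε γ S (fun c => (1 - ω c.fst * ω c.snd) * g c)| ≤
      2 * B * ∑ i, (1 - ω i) *
        collisionSum G ε γ S (fun c => if c.fst = i then ‖c.postVel.1 - c.preVel.1‖ else 0) := by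
  -- pointwise: `|(1 - ω_i ω_j) g| ≤ (1 - ω_i) B‖Δv‖ + (1 - ω_j) B‖Δv‖`
  have hpt : ∀ t ∈ collisionTimes G ε γ ∩ S, ∀ p ∈ contactPairs G ε (γ t),
      |(1 - ω p.1 * ω p.2) * g (HardSphereCollisionRecord.ofConfig G ε (γ t) t p.1 p.2)| ≤
        (1 - ω p.1) * (B * ‖(HardSphereCollisionRecord.ofConfig G ε (γ t) t p.1 p.2).postVel.1 -
            (HardSphereCollisionRecord.ofConfig G ε (γ t) t p.1 p.2).preVel.1‖) +
        (1 - ω p.2) * (B * ‖(HardSphereCollisionRecord.ofConfig G ε (γ t) t p.1 p.2).postVel.1 -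
            (HardSphereCollisionRecord.ofConfig G ε (γ t) t p.1 p.2).preVel.1‖) := by
    intro t ht p hp
    have h1 : 0 ≤ 1 - ω p.1 * ω p.2 := by nlinarith [hω0 p.1, hω0 p.2, hω1 p.1, hω1 p.2]
    have h2 : 1 - ω p.1 * ω p.2 ≤ (1 - ω p.1) + (1 - ω p.2) := by nlinarith [hω0 p.1, hω0 p.2, hω1 p.1, hω1 p.2]
    have hB := hg t ht p hp
    have hB0 : 0 ≤ B * ‖(HardSphereCollisionRecord.ofConfig G ε (γ t) t p.1 p.2).postVel.1 -
        (HardSphereCollisionRecord.ofConfig G ε (γ t) t p.1 p.2).preVel.1‖ := (abs_nonneg _).trans hB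
    rw [abs_mul, abs_of_nonneg h1, ← add_mul]
    exact mul_le_mul h2 hB (abs_nonneg _) (by linarith [hω1 p.1, hω1 p.2])
  -- sum the pointwise bound
  have hsum : |collisionSum G ε γ S (fun c => (1 - ω c.fst * ω c.snd) * g c)| ≤
      collisionSum G ε γ S (fun c => (1 - ω c.fst) * (B * ‖c.postVel.1 - c.preVel.1‖)) +
        collisionSum G ε γ S (fun c => (1 - ω c.snd) * (B * ‖c.postVel.1 - c.preVel.1‖)) := by
    rw [collisionSum_eq_finset_sum hfin, collisionSum_eq_finset_sum hfin, collisionSum_eq_finset_sum hfin,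
      ← Finset.sum_add_distrib]
    refine (Finset.abs_sum_le_sum_abs _ _).trans (Finset.sum_le_sum fun t ht => ?_)
    rw [← Finset.sum_add_distrib]
    refine (Finset.abs_sum_le_sum_abs _ _).trans (Finset.sum_le_sum fun p hp => ?_)
    simp only [HardSphereCollisionRecord.ofConfig_fst, HardSphereCollisionRecord.ofConfig_snd]
    exact hpt t ((Set.Finite.mem_toFinset hfin).1 ht) p hp
  -- the two halves are equal after the swap, and each is `B Σ_i (1 - ω_i) A_i`
  have hswap : collisionSum G ε γ S (fun c => (1 - ω c.snd) * (B * ‖c.postVel.1 - c.preVel.1‖)) =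
      collisionSum G ε γ S (fun c => (1 - ω c.fst) * (B * ‖c.postVel.1 - c.preVel.1‖)) := by
    have h := collisionSum_snd_eq_fst hG hfin (fun i => (1 - ω i) * B)
    simp only [mul_assoc] at h
    exact h
  have hfst : collisionSum G ε γ S (fun c => (1 - ω c.fst) * (B * ‖c.postVel.1 - c.preVel.1‖)) =
      B * ∑ i, (1 - ω i) *
        collisionSum G ε γ S (fun c => if c.fst = i then ‖c.postVel.1 - c.preVel.1‖ else 0) := by
    have h := collisionSum_fst_mul_eq_sum hfin (fun i => (1 - ω i) * B)
    simp only [mul_assoc] at h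
    rw [h, Finset.mul_sum]
    refine Finset.sum_congr rfl fun i _ => ?_
    ring
  rw [hswap, hfst] at hsum
  linarith

end Summit.AtomisticToContinuum.HydrodynamicLimit.Theorems.EntropyClockDock

end
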